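import Mathlib
import Summits.Ventures.HodgeRepro.MuTableSignsHermitian
import Summits.Ventures.HodgeRepro.RealApproxUnitary

/-!
# Route C's Hermitian form has dense rational points (seat p2, gen 7)

`MuTableSignsHermitian.exists_hermitian_sigP1_posDef` constructs, for every CM field `K`, every `p` and every
distinguished embedding `φ₀`, a Hermitian form `HK` of signature `(p,1)` at `φ₀` (Sylvester matrix `P`) and positive
definite at the other places.  typer-2's `RealApproxUnitary.dense_ratPointsOf` (real approximation, proved by the Cayley
transform) says that the `K`-points of the unitary group of ANY such form are dense in `U(p,1)`.  Composed: the
Route C object exists WITH the density input of Lemma W / the R5 chain, on the kernel, for every `K`, `p`, `φ₀`.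

Nothing here says anything about the status of the Hodge conjecture for CM abelian varieties.
-/

set_option autoImplicit false

namespace Summit.Ventures.HodgeRepro

open NumberField Matrix
open scoped ComplexOrder
open HodgeRepro.BallGen (Idx J GLp U ratPointsOf)

namespace MuTableSigns

variable {K : Type} [Field K] [NumberField K] [NumberField.IsCMField K]

/-- **Route C's form with dense rational points.**  For every CM field `K`, every `p` and every embedding `φ₀` there are
a Hermitian `HK ∈ M_{p+1}(K)` and a Sylvester matrix `P` at `φ₀` (`Pᴴ (φ₀ HK) P = J p`, signature `(p,1)`) such that `HK`
is positive definite at every other infinite place and the `K`-points `ratPointsOf φ₀ HK P hP` of its unitary group are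
dense in `U(p,1)` — the object of ROUTE-C R0 together with the density hypothesis of Lemma W (R5). -/
theorem exists_hermitian_dense_ratPointsOf (p : ℕ) (φ₀ : K →+* ℂ) :
    ∃ (HK : Matrix (Idx p) (Idx p) K) (P : GLp p)
      (hP : (P : Matrix (Idx p) (Idx p) ℂ)ᴴ * HK.map φ₀ * (P : Matrix (Idx p) (Idx p) ℂ) = J p),
      HKᴴ = HK ∧ (∀ φ : K →+* ℂ, InfinitePlace.mk φ ≠ InfinitePlace.mk φ₀ → (HK.map φ).PosDef) ∧
        Dense ((ratPointsOf φ₀ HK P hP : Subgroup (U p)) : Set (U p)) := by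
  obtain ⟨HK, hH, ⟨P, hP⟩, hpos⟩ := exists_hermitian_sigP1_posDef (K := K) p φ₀
  exact ⟨HK, P, hP, hH, hpos, HodgeRepro.BallGen.RealApprox.dense_ratPointsOf φ₀ HK P hP⟩

end MuTableSigns

end Summit.Ventures.HodgeRepro
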